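/-
Copyright: lit-balaban cell, Phase-2 proof seat p11 (gen 4).  Statement-level skeleton of a published paper; no proof claims beyond
what the kernel checks below.
-/
import Literature.MathematicalPhysics.QuantumFieldTheory.BalabanImbrieJaffe1984to88.BIJ85BlockAveragingIneq

/-!
# `BalabanImbrieJaffe1984to88.BIJ85Eq325Corrections` — T. Bałaban, J. Imbrie, A. Jaffe, *Renormalization of the Higgs model:
minimizers, propagators and the stability of mean field theory*, Commun. Math. Phys. **97** (1985) 299–329
[BalabanImbrieJaffe1985]: Sect. 3 p. 308 — the background field **(3.21) `u^{(1)} = u·exp(−ie(ε)A)`** typed on the torus carrier of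
record, and the sentence between (3.24) and (3.25) **PROVED with explicit constants**: expanding `u` about `u^{(1)}` in the φ-quadratic
part of (3.24) produces, relative to the leading form (3.25), corrections each of which carries a factor `e` (times `‖A‖_∞`).

statement-level skeleton of published theorems with citation tags; proofs where landed; nothing here is a claim about the Yang–Mills mass gap

PDF held: `paper:balaban1985-cmp97-bij-higgs-minimizers` (journal page = PDF page + 298).  Pages read this session: p. 302–303 [PDF 4–5],
p. 307–308 [PDF 9–10].

CITATION HEADER (lean-in-tree rule).  Phase-2 file of the lit-balaban TYPED SKELETON (HOME `run/shared/lean/pub/lit-balaban/`), seat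
p11 gen 4 (unit `lit-balaban-p11-g4`; TAKING line HOME/STATUS.md 2026-08-21T06:54:28Z; owner r15, referee ref-5; second target of the
generation, own lane = the C1 scalar sector: row **C1.Eq3.24-3.28** is this seat's gen-2 `BIJ85ScalarForm464` p248398 / torus
`BIJ85ScalarPropagatorTorus` p248857).  WHAT IS REPRODUCED: row **C1.Eq3.24-3.28** (the p. 308 sentence on the `O(e(ε))` corrections,
PROVED on the torus model) and row **C1.Eq3.19-3.21** (member (3.21), r15: *"(3.21) definition not typed"* — typed here as `uOne`).

THE PRINTED TEXT, verbatim (p. 308 [PDF 10]): *"Define the unit lattice field u^{(1)} = u exp(−ie(ε)A), (3.21) with A the fluctuation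
field defined by (3.16). … Let us now direct attention to the boson part of the integral (3.1). We expand S(u,φ) + ½a‖ψ − Q(u)φ‖² (3.24)
to identify the quadratic terms in φ. Using (3.23), we also expand u about its background value u^{(1)}, yielding additional contributions
from A which are accompanied by (small) factors O(e(ε)). Thus the leading terms in the Higgs action are ½a‖Q(u^{(1)})φ − ψ‖² +
½⟨φ, Δ_{u^{(1)}}φ⟩, (3.25) with all corrections included in the potential V₁(A,φ,f₁) which have coefficients O(ε)."* (The φ-quadratic,
u-dependent part of S(u,φ) (1.1) is the kinetic term ½Σ_b|(D_uφ)_b|²; the mass term of (1.2) does not involve u.)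

WHAT IS PROVED (0 `sorry`, standard axioms).  Carriers of record only: the torus `Balaban1983to89.Site P j` / `PBond P j`, `U(1)` fields
`GaugeField P j U1` read in `ℂ` by `toC` (r18's `expU1 θ = e^{iθ}`), the `ℓ²` spaces and maps `FineSp`/`CoarseSp`/`Dlin c u`/`Qlin u` of
gen 2 (`(D_uφ)_b = c(u_bφ(b₊) − φ(b₋))`, `Q(u)` = (2.6) with the contour transports `holC u x = u(Γ_{yx})`), gen 2's form
`BIJ85ScalarForm464.scalarForm D Q a ψ φ = ½a‖Qφ − ψ‖² + ½‖Dφ‖²` (= the φ-quadratic part of (3.24) at `(D_u, Q(u))`, = (3.25) at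
`(D_{u^{(1)}}, Q(u^{(1)}))`).  Throughout `A : PBond → ℝ` is ANY real bond field with `|A_b| ≤ M` and `e` any real (the paper's `A` is the
fluctuation field of (3.16) and `e = e(ε)`; nothing about (3.16) is used).
* §1 **(3.21)** `uOne u e A = u^{(1)}`, `u^{(1)}_b = u_b·e^{−ieA_b}`; `u_b = u^{(1)}_b·e^{ieA_b}` and `|u_b − u^{(1)}_b| ≤ |eA_b|` (`|e^{iθ} − 1| ≤ |θ|`).
* §2 kinetic term: `(D_uφ)_b − (D_{u^{(1)}}φ)_b = c(u_b − u^{(1)}_b)φ(b₊)`, so `‖D_uφ − D_{u^{(1)}}φ‖ ≤ |c|·|e|M·√d·‖φ‖`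
  (`norm_Dlin_sub_Dlin_uOne_le`; each site is the final point of `d` bonds).
* §3 contour transports: `u(Γ_{yx}) = u^{(1)}(Γ_{yx})·Π_{b∈Γ_{yx}} e^{ieA_b}` (`holC_eq_holC_uOne_mul`) and
  `|u(Γ_{yx}) − u^{(1)}(Γ_{yx})| ≤ Σ_{b∈Γ_{yx}}|eA_b| ≤ d(L−1)·|e|M` (`norm_holC_sub_holC_uOne_le`; `Γ_{yx}` has `Σ_μ inBlock x μ ≤ d(L−1)` bonds).
* §4 averaging term: `(Q(u)φ)(y) − (Q(u^{(1)})φ)(y) = L^{−d}Σ_{x∈B(y)}(u(Γ_{yx}) − u^{(1)}(Γ_{yx}))φ(x)`, so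
  `‖Q(u)φ − Q(u^{(1)})φ‖ ≤ L^{−d/2}·d(L−1)·|e|M·‖φ‖` (`norm_Qlin_sub_Qlin_uOne_le`; Jensen over the block).
* §5–§6 **THE SENTENCE**: with `δ_D = |c||e|M√d‖φ‖`, `δ_Q = L^{−d/2}d(L−1)|e|M‖φ‖`:
  `|½‖D_uφ‖² − ½‖D_{u^{(1)}}φ‖²| ≤ δ_D‖D_{u^{(1)}}φ‖ + ½δ_D²` (`abs_kinetic_sub_le`),
  `|½a‖Q(u)φ − ψ‖² − ½a‖Q(u^{(1)})φ − ψ‖²| ≤ aδ_Q‖Q(u^{(1)})φ − ψ‖ + ½aδ_Q²` (`abs_averaging_sub_le`), hence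
  **`abs_scalarForm_sub_scalarForm_uOne_le`**: |(φ-quadratic part of (3.24) at u) − (the leading form (3.25) at u^{(1)})| ≤
  `|e|·M·(…) + |e|²·M²·(…)` with the explicit brackets printed in the statement — every correction carries at least one factor `e`
  (= *"accompanied by (small) factors O(e(ε))"*), uniformly in `u`, for all `φ`, `ψ`, `a ≥ 0`, `c`.
HONEST SCOPE.  This quantifies the expansion of the φ-QUADRATIC terms only (which is what (3.25) collects); the remaining content of
`V₁(A,φ,f₁)` (the non-quadratic `P(φ)` corrections, the gauge-field part of (3.24), the dependence through `f₁`) is not addressed, nor is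
the fluctuation field `A` of (3.16) constructed (it enters as data).  The bounds are not optimized (`d(L−1)` = the number of bonds of the
longest block contour).
-/

open scoped RealInnerProductSpace BigOperators
open Finset Complex

namespace Literature.MathematicalPhysics.QuantumFieldTheory.BalabanImbrieJaffe1984to88.BIJ85Eq325Corrections

open Literature.MathematicalPhysics.QuantumFieldTheory.Balaban1983to89
open BIJ88Sect3Statements (U1 toC cfg covD norm_toC toC_one toC_mul)
open BIJ85Sect1Model (HiggsField)
open BIJ88RenormTransf311 (inBlock)
open BIJ85BlockAveragesTorus BIJ85BlockAveragesTorusK BIJ85ScalarPropagatorTorus BIJ85ScalarForm464 BIJ85BlockAveragingIneq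

noncomputable section

variable {P : Params} {j : ℕ}

/-- `Σ_x |χ(x)|² = ‖χ‖²` in an `ℓ²` space of complex fields. [folklore] -/
private theorem sum_norm_sq_eq' {ι : Type*} [Fintype ι] (χ : PiLp 2 (fun _ : ι => ℂ)) :
    ∑ x : ι, ‖χ x‖ ^ 2 = ‖χ‖ ^ 2 := by
  rw [PiLp.norm_sq_eq_of_L2]

/-! ## §1 (3.21): the background field `u^{(1)} = u·exp(−ie(ε)A)` -/

/-- **(3.21)** p. 308 [PDF 10], verbatim: *"Define the unit lattice field u^{(1)} = u exp(−ie(ε)A), (3.21) with A the fluctuation field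
defined by (3.16)."* — on the torus carrier of record: `u^{(1)}_b = u_b·e^{−ieA_b} ∈ U(1)` for a `U(1)` field `u`, a real bond field `A`
and the charge `e` (r18's `expU1`). [cite: BalabanImbrieJaffe1985, (3.21) p.308] -/
def uOne (U : GaugeField P j U1) (e : ℝ) (A : PBond P j → ℝ) : GaugeField P j U1 := fun b => U b * expU1 (-(e * A b))

/-- kernel: `u^{(1)}_b = u_b·exp(−ieA_b)` read in `ℂ`. [cite: BalabanImbrieJaffe1985, (3.21) p.308] -/
theorem toC_uOne (U : GaugeField P j U1) (e : ℝ) (A : PBond P j → ℝ) (b : PBond P j) :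
    toC (uOne U e A b) = toC (U b) * Complex.exp (-(e * A b : ℝ) * I) := by
  rw [uOne, toC_mul, toC_expU1]
  push_cast
  ring_nf

/-- kernel: (3.21) inverted, `u_b = u^{(1)}_b·exp(ieA_b)` — *"we also expand u about its background value u^{(1)}"*.
[cite: BalabanImbrieJaffe1985, (3.21) p.308] -/
theorem toC_eq_toC_uOne_mul (U : GaugeField P j U1) (e : ℝ) (A : PBond P j → ℝ) (b : PBond P j) :
    toC (U b) = toC (uOne U e A b) * Complex.exp ((e * A b : ℝ) * I) := by
  rw [toC_uOne, mul_assoc, ← Complex.exp_add]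
  push_cast
  rw [show -( (e : ℂ) * (A b : ℂ)) * I + (e : ℂ) * (A b : ℂ) * I = 0 by ring, Complex.exp_zero, mul_one]

/-- `|e^{iθ} − 1| ≤ |θ|` (Mathlib's `Real.norm_exp_I_mul_ofReal_sub_one_le`). [folklore] -/
private theorem norm_exp_mul_I_sub_one_le (θ : ℝ) : ‖Complex.exp ((θ : ℂ) * I) - 1‖ ≤ |θ| := by
  rw [mul_comm]
  have h := Real.norm_exp_I_mul_ofReal_sub_one_le (x := θ)
  rwa [Real.norm_eq_abs] at h

/-- kernel: **`|u_b − u^{(1)}_b| ≤ |eA_b|`** — the expansion of `u` about `u^{(1)}` is first order in `e`.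
[cite: BalabanImbrieJaffe1985, (3.21) p.308] -/
theorem norm_toC_sub_toC_uOne_le (U : GaugeField P j U1) (e : ℝ) (A : PBond P j → ℝ) (b : PBond P j) :
    ‖toC (U b) - toC (uOne U e A b)‖ ≤ |e * A b| := by
  rw [toC_eq_toC_uOne_mul U e A b, ← mul_sub_one, norm_mul, norm_toC, one_mul]
  exact norm_exp_mul_I_sub_one_le _

/-! ## §2 The kinetic term: `D_uφ − D_{u^{(1)}}φ` carries a factor `e` -/

/-- kernel: `(D_uφ)_b − (D_{u^{(1)}}φ)_b = c(u_b − u^{(1)}_b)φ(b₊)` for the covariant derivative of (1.1)/(4.6.3).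
[cite: BalabanImbrieJaffe1985, (3.25) p.308] -/
theorem covD_sub_covD_uOne (c e : ℝ) (U : GaugeField P j U1) (A : PBond P j → ℝ) (φ : HiggsField P j) (b : PBond P j) :
    covD c (cfg U) φ b - covD c (cfg (uOne U e A)) φ b = (c : ℂ) * ((toC (U b) - toC (uOne U e A b)) * φ b.tgt) := by
  simp only [covD, cfg]
  ring

/-- kernel: `|(D_uφ)_b − (D_{u^{(1)}}φ)_b| ≤ |c|·|eA_b|·|φ(b₊)|`. [cite: BalabanImbrieJaffe1985, (3.25) p.308] -/
theorem norm_covD_sub_covD_uOne_le (c e : ℝ) (U : GaugeField P j U1) (A : PBond P j → ℝ) (φ : HiggsField P j)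
    (b : PBond P j) :
    ‖covD c (cfg U) φ b - covD c (cfg (uOne U e A)) φ b‖ ≤ |c| * |e * A b| * ‖φ b.tgt‖ := by
  rw [covD_sub_covD_uOne, norm_mul, norm_mul, Complex.norm_real, Real.norm_eq_abs, mul_assoc]
  exact mul_le_mul_of_nonneg_left (mul_le_mul_of_nonneg_right (norm_toC_sub_toC_uOne_le U e A b) (norm_nonneg _))
    (abs_nonneg c)

/-- **The kinetic correction is `O(e)`**: `‖D_uφ − D_{u^{(1)}}φ‖ ≤ |c|·|e|·M·√d·‖φ‖` when `|A_b| ≤ M` (each site of the torus is the final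
point of exactly `d` bonds). [cite: BalabanImbrieJaffe1985, (3.25) p.308] -/
theorem norm_Dlin_sub_Dlin_uOne_le (c e : ℝ) (U : GaugeField P j U1) (A : PBond P j → ℝ) {M : ℝ} (hM : ∀ b, |A b| ≤ M)
    (φ : FineSp P j) :
    ‖Dlin c U φ - Dlin c (uOne U e A) φ‖ ≤ |c| * |e| * M * Real.sqrt P.d * ‖φ‖ := by
  have hM0 : 0 ≤ M := (abs_nonneg _).trans (hM ⟨default, ⟨0, P.hd⟩⟩)
  have hsq : ‖Dlin c U φ - Dlin c (uOne U e A) φ‖ ^ 2 ≤ (|c| * |e| * M) ^ 2 * (P.d * ‖φ‖ ^ 2) := by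
    rw [← sum_norm_sq_eq' (Dlin c U φ - Dlin c (uOne U e A) φ)]
    calc ∑ b : PBond P j, ‖(Dlin c U φ - Dlin c (uOne U e A) φ) b‖ ^ 2
        ≤ ∑ b : PBond P j, (|c| * |e| * M) ^ 2 * ‖φ b.tgt‖ ^ 2 := by
          refine sum_le_sum fun b _ => ?_
          have h1 := norm_covD_sub_covD_uOne_le c e U A (WithLp.ofLp φ) b
          have h2 : |c| * |e * A b| * ‖φ b.tgt‖ ≤ |c| * |e| * M * ‖φ b.tgt‖ := by
            rw [abs_mul, ← mul_assoc]
            exact mul_le_mul_of_nonneg_right (mul_le_mul_of_nonneg_left (hM b) (by positivity)) (norm_nonneg _)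
          have h3 : ‖(Dlin c U φ - Dlin c (uOne U e A) φ) b‖ ≤ |c| * |e| * M * ‖φ b.tgt‖ := by
            rw [PiLp.sub_apply, Dlin_apply, Dlin_apply]
            exact h1.trans h2
          calc ‖(Dlin c U φ - Dlin c (uOne U e A) φ) b‖ ^ 2 ≤ (|c| * |e| * M * ‖φ b.tgt‖) ^ 2 :=
                pow_le_pow_left₀ (norm_nonneg _) h3 2
            _ = _ := by ring
      _ = (|c| * |e| * M) ^ 2 * (P.d * ‖φ‖ ^ 2) := by
          rw [← mul_sum, sum_bond_eq]
          simp only [PBond.tgt]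
          rw [sum_sum_shift_dir (fun x => ‖φ x‖ ^ 2), sum_norm_sq_eq']
  have hR : (|c| * |e| * M) ^ 2 * (P.d * ‖φ‖ ^ 2) = (|c| * |e| * M * Real.sqrt P.d * ‖φ‖) ^ 2 := by
    have hd : Real.sqrt (P.d : ℝ) ^ 2 = P.d := Real.sq_sqrt (Nat.cast_nonneg _)
    rw [mul_pow (|c| * |e| * M * Real.sqrt P.d), mul_pow (|c| * |e| * M), hd]
    ring
  rw [hR] at hsq
  exact (pow_le_pow_iff_left₀ (norm_nonneg _) (by positivity) two_ne_zero).1 hsq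

/-! ## §3 The contour transports: `u(Γ_{yx}) − u^{(1)}(Γ_{yx})` carries a factor `e` -/

/-- `|Π_i z_i − 1| ≤ Σ_i |z_i − 1|` for factors of modulus `≤ 1`. [folklore] -/
private theorem norm_prod_sub_one_le {ι : Type*} (s : Finset ι) (z : ι → ℂ) (hz : ∀ i ∈ s, ‖z i‖ ≤ 1) :
    ‖∏ i ∈ s, z i - 1‖ ≤ ∑ i ∈ s, ‖z i - 1‖ := by
  classical
  induction s using Finset.induction_on with
  | empty => simp
  | insert a s ha ih =>
    rw [prod_insert ha, sum_insert ha]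
    have hz' : ∀ i ∈ s, ‖z i‖ ≤ 1 := fun i hi => hz i (mem_insert_of_mem hi)
    have e1 : z a * ∏ i ∈ s, z i - 1 = z a * (∏ i ∈ s, z i - 1) + (z a - 1) := by ring
    rw [e1]
    refine (norm_add_le _ _).trans ?_
    rw [norm_mul, add_comm]
    refine add_le_add le_rfl ?_
    calc ‖z a‖ * ‖∏ i ∈ s, z i - 1‖ ≤ 1 * ‖∏ i ∈ s, z i - 1‖ :=
          mul_le_mul_of_nonneg_right (hz a (mem_insert_self a s)) (norm_nonneg _)
      _ ≤ _ := by rw [one_mul]; exact ih hz'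

/-- kernel: **`u(Γ_{yx}) = u^{(1)}(Γ_{yx})·Π_{b∈Γ_{yx}} e^{ieA_b}`** for the block contours of (2.5)/(2.6) (r18's `holC` = the product over the
legs and their bonds `legBond x μ t`, `t < inBlock x μ`; abelian). [cite: BalabanImbrieJaffe1985, (2.5) p.302] -/
theorem holC_eq_holC_uOne_mul (U : GaugeField P j U1) (e : ℝ) (A : PBond P j → ℝ) (x : Balaban1983to89.Site P j) :
    holC U x = holC (uOne U e A) x *
      ∏ μ : Fin P.d, ∏ t ∈ range (inBlock x μ), Complex.exp ((e * A (legBond x μ t) : ℝ) * I) := by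
  unfold holC legProd
  rw [← prod_mul_distrib]
  refine prod_congr rfl fun μ _ => ?_
  rw [← prod_mul_distrib]
  exact prod_congr rfl fun t _ => toC_eq_toC_uOne_mul U e A _

/-- **The contour transports differ by `O(e)`**: `|u(Γ_{yx}) − u^{(1)}(Γ_{yx})| ≤ d·(L−1)·|e|·M` (`|Π e^{iθ_b} − 1| ≤ Σ|θ_b|`, and `Γ_{yx}`
has `Σ_μ inBlock x μ ≤ d(L−1)` bonds). [cite: BalabanImbrieJaffe1985, (2.6) p.303] -/
theorem norm_holC_sub_holC_uOne_le (U : GaugeField P j U1) (e : ℝ) (A : PBond P j → ℝ) {M : ℝ}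
    (hM : ∀ b, |A b| ≤ M) (x : Balaban1983to89.Site P j) :
    ‖holC U x - holC (uOne U e A) x‖ ≤ P.d * (P.L - 1 : ℕ) * (|e| * M) := by
  have hM0 : 0 ≤ M := (abs_nonneg _).trans (hM ⟨default, ⟨0, P.hd⟩⟩)
  rw [holC_eq_holC_uOne_mul U e A x, ← mul_sub_one, norm_mul, norm_holC, one_mul]
  have hin : ∀ μ : Fin P.d, ‖∏ t ∈ range (inBlock x μ), Complex.exp ((e * A (legBond x μ t) : ℝ) * I)‖ ≤ 1 := fun μ => by
    rw [norm_prod, prod_eq_one fun t _ => Complex.norm_exp_ofReal_mul_I _]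
  refine (norm_prod_sub_one_le _ _ fun μ _ => hin μ).trans ?_
  refine (sum_le_sum fun μ _ => norm_prod_sub_one_le _ _ fun t _ => (Complex.norm_exp_ofReal_mul_I _).le).trans ?_
  calc ∑ μ : Fin P.d, ∑ t ∈ range (inBlock x μ), ‖Complex.exp ((e * A (legBond x μ t) : ℝ) * I) - 1‖
      ≤ ∑ μ : Fin P.d, ∑ t ∈ range (inBlock x μ), |e| * M := by
        refine sum_le_sum fun μ _ => sum_le_sum fun t _ => ?_
        refine (norm_exp_mul_I_sub_one_le _).trans ?_
        rw [abs_mul]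
        exact mul_le_mul_of_nonneg_left (hM _) (abs_nonneg _)
    _ ≤ ∑ _μ : Fin P.d, ((P.L - 1 : ℕ) : ℝ) * (|e| * M) := by
        refine sum_le_sum fun μ _ => ?_
        rw [sum_const, card_range, nsmul_eq_mul]
        refine mul_le_mul_of_nonneg_right ?_ (by positivity)
        have : inBlock x μ < P.L := Nat.mod_lt _ P.L_pos
        exact_mod_cast (show inBlock x μ ≤ P.L - 1 by omega)
    _ = _ := by rw [sum_const, card_univ, Fintype.card_fin, nsmul_eq_mul, mul_assoc]

/-! ## §4 The averaging term: `Q(u)φ − Q(u^{(1)})φ` carries a factor `e` -/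

/-- kernel: `(Q(u)φ)(y) − (Q(u^{(1)})φ)(y) = L^{−d}Σ_{x∈B(y)} (u(Γ_{yx}) − u^{(1)}(Γ_{yx}))φ(x)` ((2.6)). [cite: BalabanImbrieJaffe1985, (2.6) p.303] -/
theorem qCov_sub_qCov_uOne (U : GaugeField P j U1) (e : ℝ) (A : PBond P j → ℝ) (φ : HiggsField P j)
    (y : Balaban1983to89.Site P (j+1)) :
    qCov U φ y - qCov (uOne U e A) φ y = ((P.L : ℂ) ^ P.d)⁻¹ * ∑ x ∈ block y, (holC U x - holC (uOne U e A) x) * φ x := by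
  rw [qCov_apply, qCov_apply, ← mul_sub, ← sum_sub_distrib]
  congr 1
  exact sum_congr rfl fun x _ => by ring

/-- kernel (one block): `|(Q(u)φ)(y) − (Q(u^{(1)})φ)(y)|² ≤ L^{−d}·(d(L−1)|e|M)²·Σ_{x∈B(y)}|φ(x)|²` (Jensen over the `L^d` points of
`B(y)`; standing range). [cite: BalabanImbrieJaffe1985, (2.6) p.303] -/
theorem norm_qCov_sub_qCov_uOne_sq_le (hj : j + 1 ≤ P.m + P.K) (U : GaugeField P j U1) (e : ℝ) (A : PBond P j → ℝ) {M : ℝ}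
    (hM : ∀ b, |A b| ≤ M) (φ : HiggsField P j) (y : Balaban1983to89.Site P (j+1)) :
    ‖qCov U φ y - qCov (uOne U e A) φ y‖ ^ 2
      ≤ ((P.L : ℝ) ^ P.d)⁻¹ * (P.d * (P.L - 1 : ℕ) * (|e| * M)) ^ 2 * ∑ x ∈ block y, ‖φ x‖ ^ 2 := by
  set K : ℝ := P.d * (P.L - 1 : ℕ) * (|e| * M) with hK
  have hN : (0 : ℝ) < (P.L : ℝ) ^ P.d := pow_pos (Nat.cast_pos.2 P.L_pos) _
  rw [qCov_sub_qCov_uOne, norm_mul, mul_pow, norm_inv, norm_pow, Complex.norm_natCast]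
  have h1 : ‖∑ x ∈ block y, (holC U x - holC (uOne U e A) x) * φ x‖ ^ 2
      ≤ (block y).card * ∑ x ∈ block y, ‖(holC U x - holC (uOne U e A) x) * φ x‖ ^ 2 :=
    calc _ ≤ (∑ x ∈ block y, ‖(holC U x - holC (uOne U e A) x) * φ x‖) ^ 2 :=
          pow_le_pow_left₀ (norm_nonneg _) (norm_sum_le _ _) 2
      _ ≤ _ := sq_sum_le_card_mul_sum_sq
  rw [Balaban1983to89.Site.card_block hj y, Nat.cast_pow] at h1
  have h2 : ∑ x ∈ block y, ‖(holC U x - holC (uOne U e A) x) * φ x‖ ^ 2 ≤ ∑ x ∈ block y, K ^ 2 * ‖φ x‖ ^ 2 := by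
    refine sum_le_sum fun x _ => ?_
    rw [norm_mul, mul_pow]
    exact mul_le_mul_of_nonneg_right (pow_le_pow_left₀ (norm_nonneg _) (norm_holC_sub_holC_uOne_le U e A hM x) 2)
      (by positivity)
  rw [← mul_sum] at h2
  calc ((P.L : ℝ) ^ P.d)⁻¹ ^ 2 * ‖∑ x ∈ block y, (holC U x - holC (uOne U e A) x) * φ x‖ ^ 2
      ≤ ((P.L : ℝ) ^ P.d)⁻¹ ^ 2 * ((P.L : ℝ) ^ P.d * (K ^ 2 * ∑ x ∈ block y, ‖φ x‖ ^ 2)) :=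
        mul_le_mul_of_nonneg_left (h1.trans (mul_le_mul_of_nonneg_left h2 hN.le)) (by positivity)
    _ = _ := by
        rw [pow_two, mul_assoc, ← mul_assoc ((P.L : ℝ) ^ P.d)⁻¹ ((P.L : ℝ) ^ P.d), inv_mul_cancel₀ hN.ne', one_mul, mul_assoc]

/-- **The averaging correction is `O(e)`**: `‖Q(u)φ − Q(u^{(1)})φ‖ ≤ L^{−d/2}·d(L−1)·|e|·M·‖φ‖` (the blocks partition the torus;
standing range). [cite: BalabanImbrieJaffe1985, (3.25) p.308] -/
theorem norm_Qlin_sub_Qlin_uOne_le (hj : j + 1 ≤ P.m + P.K) (U : GaugeField P j U1) (e : ℝ) (A : PBond P j → ℝ) {M : ℝ}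
    (hM : ∀ b, |A b| ≤ M) (φ : FineSp P j) :
    ‖Qlin U φ - Qlin (uOne U e A) φ‖ ≤ (Real.sqrt ((P.L : ℝ) ^ P.d))⁻¹ * (P.d * (P.L - 1 : ℕ) * (|e| * M)) * ‖φ‖ := by
  have hM0 : 0 ≤ M := (abs_nonneg _).trans (hM ⟨default, ⟨0, P.hd⟩⟩)
  set K : ℝ := P.d * (P.L - 1 : ℕ) * (|e| * M) with hK
  have hK0 : 0 ≤ K := by positivity
  have hN : (0 : ℝ) < (P.L : ℝ) ^ P.d := pow_pos (Nat.cast_pos.2 P.L_pos) _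
  have hsq : ‖Qlin U φ - Qlin (uOne U e A) φ‖ ^ 2 ≤ ((P.L : ℝ) ^ P.d)⁻¹ * K ^ 2 * ‖φ‖ ^ 2 := by
    rw [← sum_norm_sq_eq' (Qlin U φ - Qlin (uOne U e A) φ), ← sum_norm_sq_eq' φ]
    calc ∑ y : Balaban1983to89.Site P (j+1), ‖(Qlin U φ - Qlin (uOne U e A) φ) y‖ ^ 2
        ≤ ∑ y : Balaban1983to89.Site P (j+1), ((P.L : ℝ) ^ P.d)⁻¹ * K ^ 2 * ∑ x ∈ block y, ‖φ x‖ ^ 2 := by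
          refine sum_le_sum fun y _ => ?_
          rw [PiLp.sub_apply, Qlin_apply, Qlin_apply]
          exact norm_qCov_sub_qCov_uOne_sq_le hj U e A hM (WithLp.ofLp φ) y
      _ = ((P.L : ℝ) ^ P.d)⁻¹ * K ^ 2 * ∑ x : Balaban1983to89.Site P j, ‖φ x‖ ^ 2 := by
          rw [← mul_sum]
          congr 1
          simp only [block]
          exact sum_fiberwise univ blockOf (fun x => ‖φ x‖ ^ 2)
  clear_value K
  have hR : ((P.L : ℝ) ^ P.d)⁻¹ * K ^ 2 * ‖φ‖ ^ 2 = ((Real.sqrt ((P.L : ℝ) ^ P.d))⁻¹ * K * ‖φ‖) ^ 2 := by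
    have hs : (Real.sqrt ((P.L : ℝ) ^ P.d)) ^ 2 = (P.L : ℝ) ^ P.d := Real.sq_sqrt hN.le
    rw [mul_pow, mul_pow, inv_pow, hs]
  rw [hR] at hsq
  exact (pow_le_pow_iff_left₀ (norm_nonneg _) (by positivity) two_ne_zero).1 hsq

/-! ## §5 The two corrections of the φ-quadratic part of (3.24) relative to (3.25) -/

/-- `|‖v + w‖² − ‖v‖²| ≤ 2‖v‖‖w‖ + ‖w‖²`. [folklore] -/
private theorem abs_norm_add_sq_sub_norm_sq_le {E : Type*} [SeminormedAddCommGroup E] (v w : E) :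
    |‖v + w‖ ^ 2 - ‖v‖ ^ 2| ≤ 2 * ‖v‖ * ‖w‖ + ‖w‖ ^ 2 := by
  have h1 : ‖v + w‖ ≤ ‖v‖ + ‖w‖ := norm_add_le v w
  have h2 : ‖v‖ ≤ ‖v + w‖ + ‖w‖ := by
    have := norm_sub_le (v + w) w
    rwa [add_sub_cancel_right] at this
  rw [abs_le]
  constructor
  · nlinarith [norm_nonneg (v + w), norm_nonneg v, norm_nonneg w]
  · nlinarith [norm_nonneg (v + w), norm_nonneg v, norm_nonneg w]

/-- **Kinetic part of the sentence**: `|½‖D_uφ‖² − ½‖D_{u^{(1)}}φ‖²| ≤ δ_D·‖D_{u^{(1)}}φ‖ + ½δ_D²`, `δ_D = |c||e|M√d‖φ‖` — the correction to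
`½⟨φ, Δ_{u^{(1)}}φ⟩` of (3.25) carries a factor `e`. [cite: BalabanImbrieJaffe1985, (3.25) p.308] -/
theorem abs_kinetic_sub_le (c e : ℝ) (U : GaugeField P j U1) (A : PBond P j → ℝ) {M : ℝ} (hM : ∀ b, |A b| ≤ M)
    (φ : FineSp P j) :
    |(1 / 2 : ℝ) * ‖Dlin c U φ‖ ^ 2 - (1 / 2 : ℝ) * ‖Dlin c (uOne U e A) φ‖ ^ 2|
      ≤ (|c| * |e| * M * Real.sqrt P.d * ‖φ‖) * ‖Dlin c (uOne U e A) φ‖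
        + (1 / 2 : ℝ) * (|c| * |e| * M * Real.sqrt P.d * ‖φ‖) ^ 2 := by
  set δ := |c| * |e| * M * Real.sqrt P.d * ‖φ‖ with hδ
  have hw : ‖Dlin c U φ - Dlin c (uOne U e A) φ‖ ≤ δ := norm_Dlin_sub_Dlin_uOne_le c e U A hM φ
  have h := abs_norm_add_sq_sub_norm_sq_le (Dlin c (uOne U e A) φ) (Dlin c U φ - Dlin c (uOne U e A) φ)
  rw [add_sub_cancel] at h
  have hv0 := norm_nonneg (Dlin c (uOne U e A) φ)
  have hw0 := norm_nonneg (Dlin c U φ - Dlin c (uOne U e A) φ)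
  rw [← mul_sub, abs_mul, abs_of_pos (by norm_num : (0 : ℝ) < 1 / 2)]
  nlinarith [mul_le_mul_of_nonneg_left hw hv0, pow_le_pow_left₀ hw0 hw 2]

/-- **Averaging part of the sentence**: `|½a‖Q(u)φ − ψ‖² − ½a‖Q(u^{(1)})φ − ψ‖²| ≤ a·δ_Q·‖Q(u^{(1)})φ − ψ‖ + ½a·δ_Q²`,
`δ_Q = L^{−d/2}d(L−1)|e|M‖φ‖` (`a ≥ 0`; standing range) — the correction to `½a‖Q(u^{(1)})φ − ψ‖²` of (3.25) carries a factor `e`.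
[cite: BalabanImbrieJaffe1985, (3.25) p.308] -/
theorem abs_averaging_sub_le (hj : j + 1 ≤ P.m + P.K) {a : ℝ} (ha : 0 ≤ a) (e : ℝ) (U : GaugeField P j U1)
    (A : PBond P j → ℝ) {M : ℝ} (hM : ∀ b, |A b| ≤ M) (ψ : CoarseSp P j) (φ : FineSp P j) :
    |(1 / 2 : ℝ) * a * ‖Qlin U φ - ψ‖ ^ 2 - (1 / 2 : ℝ) * a * ‖Qlin (uOne U e A) φ - ψ‖ ^ 2|
      ≤ a * (((Real.sqrt ((P.L : ℝ) ^ P.d))⁻¹ * (P.d * (P.L - 1 : ℕ) * (|e| * M)) * ‖φ‖) * ‖Qlin (uOne U e A) φ - ψ‖)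
        + (1 / 2 : ℝ) * a * ((Real.sqrt ((P.L : ℝ) ^ P.d))⁻¹ * (P.d * (P.L - 1 : ℕ) * (|e| * M)) * ‖φ‖) ^ 2 := by
  set δ := (Real.sqrt ((P.L : ℝ) ^ P.d))⁻¹ * (P.d * (P.L - 1 : ℕ) * (|e| * M)) * ‖φ‖ with hδ
  have hw : ‖Qlin U φ - Qlin (uOne U e A) φ‖ ≤ δ := norm_Qlin_sub_Qlin_uOne_le hj U e A hM φ
  have h := abs_norm_add_sq_sub_norm_sq_le (Qlin (uOne U e A) φ - ψ) (Qlin U φ - Qlin (uOne U e A) φ)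
  rw [show Qlin (uOne U e A) φ - ψ + (Qlin U φ - Qlin (uOne U e A) φ) = Qlin U φ - ψ by abel] at h
  have hv0 := norm_nonneg (Qlin (uOne U e A) φ - ψ)
  have hw0 := norm_nonneg (Qlin U φ - Qlin (uOne U e A) φ)
  rw [← mul_sub, abs_mul, abs_of_nonneg (by positivity : (0 : ℝ) ≤ 1 / 2 * a)]
  have ha2 : 0 ≤ (1 / 2 : ℝ) * a := by positivity
  nlinarith [mul_le_mul_of_nonneg_left hw hv0, pow_le_pow_left₀ hw0 hw 2,
    mul_le_mul_of_nonneg_left h ha2, mul_nonneg ha2 hv0, mul_nonneg ha hv0]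

/-! ## §6 THE p. 308 SENTENCE: the corrections to the leading form (3.25) carry factors `O(e(ε))` -/

/-- **THE p. 308 SENTENCE, PROVED**: *"Using (3.23), we also expand u about its background value u^{(1)}, yielding additional contributions
from A which are accompanied by (small) factors O(e(ε)). Thus the leading terms in the Higgs action are ½a‖Q(u^{(1)})φ − ψ‖² +
½⟨φ, Δ_{u^{(1)}}φ⟩, (3.25)"* — for every `U(1)` field `u` on the torus, every real bond field `A` with `|A_b| ≤ M`, every `e`, `c`, `a ≥ 0`,
`φ`, `ψ` (standing range): |(φ-quadratic part of (3.24) at `u`: `½a‖Q(u)φ − ψ‖² + ½‖D_uφ‖²`) − (the leading form (3.25) at `u^{(1)} = ue^{−ieA}`)|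
`≤ |e|·M·(|c|√d‖φ‖‖D_{u^{(1)}}φ‖ + a·L^{−d/2}d(L−1)‖φ‖‖Q(u^{(1)})φ − ψ‖) + |e|²·M²·(½(|c|√d‖φ‖)² + ½a(L^{−d/2}d(L−1)‖φ‖)²)`: every correction
carries at least one factor `e`. [cite: BalabanImbrieJaffe1985, (3.25) p.308] -/
theorem abs_scalarForm_sub_scalarForm_uOne_le (hj : j + 1 ≤ P.m + P.K) (c : ℝ) {a : ℝ} (ha : 0 ≤ a) (e : ℝ)
    (U : GaugeField P j U1) (A : PBond P j → ℝ) {M : ℝ} (hM : ∀ b, |A b| ≤ M) (ψ : CoarseSp P j) (φ : FineSp P j) :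
    |scalarForm (Dlin c U) (Qlin U) a ψ φ - scalarForm (Dlin c (uOne U e A)) (Qlin (uOne U e A)) a ψ φ|
      ≤ |e| * (M * (|c| * Real.sqrt P.d * ‖φ‖ * ‖Dlin c (uOne U e A) φ‖
            + a * ((Real.sqrt ((P.L : ℝ) ^ P.d))⁻¹ * (P.d * (P.L - 1 : ℕ)) * ‖φ‖ * ‖Qlin (uOne U e A) φ - ψ‖)))
        + |e| ^ 2 * (M ^ 2 * ((1 / 2 : ℝ) * (|c| * Real.sqrt P.d * ‖φ‖) ^ 2
            + (1 / 2 : ℝ) * a * ((Real.sqrt ((P.L : ℝ) ^ P.d))⁻¹ * (P.d * (P.L - 1 : ℕ)) * ‖φ‖) ^ 2)) := by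
  have h1 := abs_kinetic_sub_le c e U A hM φ
  have h2 := abs_averaging_sub_le hj ha e U A hM ψ φ
  have e0 : scalarForm (Dlin c U) (Qlin U) a ψ φ - scalarForm (Dlin c (uOne U e A)) (Qlin (uOne U e A)) a ψ φ
      = ((1 / 2 : ℝ) * a * ‖Qlin U φ - ψ‖ ^ 2 - (1 / 2 : ℝ) * a * ‖Qlin (uOne U e A) φ - ψ‖ ^ 2)
        + ((1 / 2 : ℝ) * ‖Dlin c U φ‖ ^ 2 - (1 / 2 : ℝ) * ‖Dlin c (uOne U e A) φ‖ ^ 2) := by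
    simp only [scalarForm]; ring
  rw [e0]
  refine (abs_add_le _ _).trans ?_
  refine (add_le_add h2 h1).trans (le_of_eq ?_)
  ring

end

end Literature.MathematicalPhysics.QuantumFieldTheory.BalabanImbrieJaffe1984to88.BIJ85Eq325Corrections
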